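import Mathlib
import HarnessLib
import Summits.RiemannHypothesis.RiemannHypothesis.Theorems.PfPersistenceDepthSplit

/-!
# Depth blindness: a bottom-`K` frame cannot see a negative ground state that keeps mass outside it
(pub-rhpf THEORY-4 §8.5, conclusion (b) for fake seats; mechanism search — no RH claims)

Necessary half of the detection criterion of `PfPersistenceDepthSplit` (`inside_negative_iff`).
Setting (dictionary THEOREM-informal, as there): `B` = a control's window form `Q_c` (symmetric
bilinear), `u` its unit ground state with `B u v = ε ⟪u,v⟫`, `ε = ε₁ᶜ < 0`; `u = uin + uout`,
`uin` = projection onto ζ's bottom-`K` eigenframe, `uout ⟂ uin`, `θ = ‖uout‖²` = mass outside the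
frame; `μ` = a lower Rayleigh bound of `B` on the actual tail vector, `μ θ ≤ B uout uout` (DATA per
window: the tail of ζ's frame is `Q_c`-stiff, `μ` of order `1 … 10³`).

* `outEnergy_lt_of_inside_negative` : `B uin uin < 0 → B uout uout < |ε|`;
* `outMass_lt_of_inside_negative`   : with `0 < μ`, `μ θ ≤ B uout uout`: `B uin uin < 0 → θ < |ε| / μ`;
* `inside_nonneg_of_outMass_ge`     : BLINDNESS — `|ε| / μ ≤ θ → 0 ≤ B uin uin`: the projected ground
  state is not a negative witness at depth `K` as long as the state keeps at least `|ε₁ᶜ|/μ` of its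
  mass beyond level `K`.  For a Type-D control at onset (`|ε₁ᶜ| ~ 10⁻²⁹`, DATA) this forces
  essentially the FULL dimension before `uin` turns negative (job `t4g3L`: `K_sign = n`); the lemma is
  the kernel-checked reason, the thresholds are DATA.

Pure linear algebra ([folklore]); decls in `…PfPersistence.DepthBlindness`.
-/

set_option linter.dupNamespace false  -- the mandated namespace repeats `RiemannHypothesis`

noncomputable section

open scoped InnerProductSpace

namespace Summit.RiemannHypothesis.RiemannHypothesis.Theorems.PfPersistence.DepthBlindness

open Summit.RiemannHypothesis.RiemannHypothesis.Theorems.PfPersistence.DepthSplit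

variable {E : Type*} [NormedAddCommGroup E] [InnerProductSpace ℝ E]

/-- PROVED (necessary half of the detection criterion): if the projection `uin` of the unit ground
state onto the frame is `B`-negative then the control-energy of the outside part is below `|ε|`.
[folklore] -/
theorem outEnergy_lt_of_inside_negative (B : E →ₗ[ℝ] E →ₗ[ℝ] ℝ) (hsymm : ∀ x y, B x y = B y x)
    (u uin uout : E) (ε : ℝ) (heig : ∀ v, B u v = ε * ⟪u, v⟫_ℝ) (hsplit : u = uin + uout)
    (horth : ⟪uin, uout⟫_ℝ = 0) (hunit : ‖u‖ = 1) (hε : ε < 0) (hin : B uin uin < 0) :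
    B uout uout < |ε| := by
  rw [inside_negative_iff B hsymm u uin uout ε heig hsplit horth, hunit] at hin
  rw [abs_of_neg hε]
  nlinarith [sq_nonneg ‖uout‖, hin, hε]

/-- PROVED (mass form): if moreover `B` is `μ`-coercive on the actual tail vector,
`μ ‖uout‖² ≤ B uout uout` with `0 < μ`, then `B uin uin < 0` forces `‖uout‖² < |ε| / μ`:
detection at depth `K` needs all but `|ε₁ᶜ|/μ` of the ground state's mass inside the frame.
[folklore] -/
theorem outMass_lt_of_inside_negative (B : E →ₗ[ℝ] E →ₗ[ℝ] ℝ) (hsymm : ∀ x y, B x y = B y x)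
    (u uin uout : E) (ε μ : ℝ) (heig : ∀ v, B u v = ε * ⟪u, v⟫_ℝ) (hsplit : u = uin + uout)
    (horth : ⟪uin, uout⟫_ℝ = 0) (hunit : ‖u‖ = 1) (hε : ε < 0) (hμ : 0 < μ)
    (hcoer : μ * ‖uout‖ ^ 2 ≤ B uout uout) (hin : B uin uin < 0) :
    ‖uout‖ ^ 2 < |ε| / μ := by
  have h := outEnergy_lt_of_inside_negative B hsymm u uin uout ε heig hsplit horth hunit hε hin
  rw [lt_div_iff₀ hμ]
  linarith

/-- PROVED (BLINDNESS, conclusion (b)): with the same hypotheses, if the ground state keeps at least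
`|ε| / μ` of its mass outside the bottom-`K` frame then its projection onto the frame is NOT
`B`-negative: `0 ≤ B uin uin`. [folklore] -/
theorem inside_nonneg_of_outMass_ge (B : E →ₗ[ℝ] E →ₗ[ℝ] ℝ) (hsymm : ∀ x y, B x y = B y x)
    (u uin uout : E) (ε μ : ℝ) (heig : ∀ v, B u v = ε * ⟪u, v⟫_ℝ) (hsplit : u = uin + uout)
    (horth : ⟪uin, uout⟫_ℝ = 0) (hunit : ‖u‖ = 1) (hε : ε < 0) (hμ : 0 < μ)
    (hcoer : μ * ‖uout‖ ^ 2 ≤ B uout uout) (hmass : |ε| / μ ≤ ‖uout‖ ^ 2) :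
    0 ≤ B uin uin := by
  rcases lt_or_ge (B uin uin) 0 with hneg | hge
  · have h := outMass_lt_of_inside_negative B hsymm u uin uout ε μ heig hsplit horth hunit hε hμ hcoer hneg
    linarith
  · exact hge

/-- PROVED (sharper mass form, recorded for the tables): `B uin uin < 0` with `μ`-coercive tail gives
`‖uout‖² · (μ + 2|ε|) < |ε|`. [folklore] -/
theorem outMass_sharp_of_inside_negative (B : E →ₗ[ℝ] E →ₗ[ℝ] ℝ) (hsymm : ∀ x y, B x y = B y x)
    (u uin uout : E) (ε μ : ℝ) (heig : ∀ v, B u v = ε * ⟪u, v⟫_ℝ) (hsplit : u = uin + uout)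
    (horth : ⟪uin, uout⟫_ℝ = 0) (hunit : ‖u‖ = 1) (hε : ε < 0)
    (hcoer : μ * ‖uout‖ ^ 2 ≤ B uout uout) (hin : B uin uin < 0) :
    ‖uout‖ ^ 2 * (μ + 2 * |ε|) < |ε| := by
  rw [inside_negative_iff B hsymm u uin uout ε heig hsplit horth, hunit] at hin
  rw [abs_of_neg hε]
  nlinarith [sq_nonneg ‖uout‖, hin, hε, hcoer]

end Summit.RiemannHypothesis.RiemannHypothesis.Theorems.PfPersistence.DepthBlindness

end
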